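import Literature.MathematicalPhysics.QuantumFieldTheory.Balaban1983to89.B4Eq220CommutatorField

/-!
# [B4] (2.18)/(2.20): THE FIRST FACTOR «h_{ω₀}G_k(□_{ω₀},Ã_{ω₀})h_{ω₀}» OF THE WALK EXPANSION AND ITS CONSTANT `c₁` FOR
# THE MEMBERS OF (1.10) — the Leibniz rule (2.3) for `D^η_{Ã,μ}(hΦ)`, and the bounds
# `‖hG_k(□,Ã)(hΦ)‖_∞ ≤ c₁‖Φ‖_∞`, `‖D^η_{Ã,μ}(hG_k(□,Ã)(hΦ))‖_∞ ≤ c₁′‖Φ‖_∞` at a regular field `Ã = A₀ + A′` on a box,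
# from Lemma 2.2 (2.17) of [Balaban1983RegularityDecay]

statement-level skeleton of published theorems with citation tags; proofs where landed; nothing here is a claim about the Yang–Mills mass gap

CITATION HEADER.  T. Bałaban, *Regularity and decay of lattice Green's functions*, Commun. Math. Phys. **89** (1983)
571–597, doi:10.1007/bf01214744 [Balaban1983RegularityDecay] (cell paper B4; held text
`paper:balaban1983-cmp89-regularity-decay`, journal page = PDF page + 570; pp. 575–578).  Unit `lit-balaban-p35` gen 5,
HOME `run/shared/lean/pub/lit-balaban/`, SKELETON rows **B4.Eq2.2** (`G₀ = Σ_jh_jG_k(□_j,Ã_j)h_j`, the letters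
`h_jG_k(□_j,Ã_j)h_j`) and **B4.Eq2.18** ((2.18)–(2.22): the constant `c₁` of (2.20)–(2.22)).  Theorems only; imports
`B4Eq220CommutatorField` (→ the Lemma-2.2 lineage at `Ã`: `B4Lemma22CrossSup.lemma22_17_sup_box`,
`B4Lemma22SupStair.lemma22_17_sup_stair`; `B4Eq220CommutatorZeroBox.HSize`; r01's `B4Eq220PartitionSizes.hsize_hBox`).
Companion of `B4Eq220FactorField` (the factors `K_jG_k(□_j,Ã_j)h_j`, constant `c₂O(1)M⁻¹`).

WHAT IS PRINTED.  p. 575, (2.3): «(D^η_A hφ)(b) = h(b₊)(D^η_Aφ)(b) + (∂^ηh)(b)φ(b₋), where h is a real valued function»;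
p. 578: «(2.18) (the left hand side of (1.9)) ≤ Σ′_ω‖h_{ω₀}G_k(□_{ω₀},Ã_{ω₀})h_{ω₀}K_{ω₁}G_k(□_{ω₁},Ã_{ω₁})h_{ω₁} · … ·
K_{ω_n}G(□_{ω_n},Ã_{ω_n})h_{ω_n}f‖_{1,α}, where ω₀ and ω_n are each restricted to 2^d possible values of j by the conditions
x, x′ ∈ □_{ω₀}, supp f ⊂ □_{ω_n}. … We estimate the first sum using Lemma 2.2 by (2.20) Σ′_{ω:n≤n₀}c₁‖K_{ω₁}G_k(□_{ω₁},Ã_{ω₁})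
h_{ω₁}‖_∞ · … ‖f‖_∞»; p. 573, (1.10): «|(D^η_{A,μ}G_k(Ω,A)f)(x)|, |(G_k(Ω,A)f)(x)| ≤ c₀exp(−δ₀dist(x, supp f))‖f‖_∞».

WHAT THIS MODULE PROVES (all in full).
* §1 **(2.3) FOR THE LINEAGE'S `D^η_{W,μ}`** on any region `R ⊂ ℤ^{d+1}` with any links `W`: `fld_covDeriv_mulH_of_mem`
  (`D_μ(hΦ)(x) = h(x + e_μ)(D_μΦ)(x) + n(h(x + e_μ) − h(x))Φ(x)` when the bond lies in `R`), `fld_covDeriv_mulH_of_not_mem`;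
  hence `siteNorm_covDeriv_mulH_le`, **`supN_covDeriv_mulH_le`**, **`lpM_covDeriv_mulH_le`**:
  `‖D_μ(hΦ)‖ ≤ ‖D_μΦ‖ + δ₁‖Φ‖` in `‖·‖_∞` and in every `‖·‖_p`, `p ≥ 1`, under `|h| ≤ 1`, `|∂^η_μh| ≤ δ₁`.
* §2 **THE CONSTANT `c₁` FOR THE MEMBERS OF (1.10) AT A REGULAR FIELD ON A BOX**: with the constant `c` of Lemma 2.2 in
  the sup norm (`B4Lemma22CrossSup.lemma22_17_sup_box`, general contour system; `B4Lemma22SupStair.lemma22_17_sup_stair`,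
  staircase contours with the operator-side hypotheses discharged), for every `h` with the sizes `HSize` and every `Φ`:
  `‖hG_k(□,Ã)(hΦ)‖_∞ ≤ 2(d+2)c‖Φ‖_∞` and `‖D^η_{Ã,μ}(hG_k(□,Ã)(hΦ))‖_∞ ≤ (1 + ℓθ + δ₁)·2(d+2)c‖Φ‖_∞`
  (`eq218_first_sup_box`, `eq218_first_sup_stair`); for [B4]'s own `h_j` (`hsize_hBox`, `δ₁ = s/K`):
  `eq218_first_hBox_sup_stair`.

HONEST SCOPE.  (i) Only the sup and sup-of-derivative parts of `‖·‖_{1,α}` (the members of (1.10)); the Hölder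
difference quotient of (2.14) (needed for (1.9)) is not treated here (`B4Lemma22HolderBox` has (2.16) at `Ã`).  (ii)
Boxes (interior cubes «x, x′ ∈ □_{ω₀}», `dist(x, Ω^c) ≥ R₀`), regular `Ã = A₀ + A′` with the lineage's hypotheses and the
printed smallness; counting-measure sup norms (no `η`-weights at `p = q = ∞`).  (iii) Nothing of (2.12)–(2.13),
(2.19)–(2.22) is summed here (`B4RandomWalk213`, `B4LpChain221`, `B4Ineq110WalkRoute`).  No `def`, no `Prop` fact, no
`sorry`; axioms standard.
-/

namespace Literature.MathematicalPhysics.QuantumFieldTheory.Balaban1983to89.B4Eq218FirstFactor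

open Finset Matrix
open Literature.MathematicalPhysics.QuantumFieldTheory.Balaban1983to89.B4GaugeCovariance
open Literature.MathematicalPhysics.QuantumFieldTheory.Balaban1983to89.B4Commutators25to211 (mulH fld_mulH_mulVec)
open Literature.MathematicalPhysics.QuantumFieldTheory.Balaban1983to89.B4Reflection242 (boxDom nbrs mem_nbrs)
open Literature.MathematicalPhysics.QuantumFieldTheory.Balaban1983to89.B4Lower18Regular (e1 lsum baseEmb stairContour)
open Literature.MathematicalPhysics.QuantumFieldTheory.Balaban1983to89.B4Lemma21Region (siteNorm covDeriv
  fld_covDeriv_mulVec_of_mem fld_covDeriv_mulVec_of_not_mem)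
open Literature.MathematicalPhysics.QuantumFieldTheory.Balaban1983to89.B4Lemma22Reduce231 (supN le_supN supN_le
  supN_nonneg siteNorm_nonneg siteNorm_add_le siteNorm_smul siteNorm_zero)
open Literature.MathematicalPhysics.QuantumFieldTheory.Balaban1983to89.B4Lemma22ReduceZero (Box opA greenA derivA
  derivA0)
open Literature.MathematicalPhysics.QuantumFieldTheory.Balaban1983to89.B4Lemma22LpStair (lpS lpM lpS_nonneg lpM_nonneg
  lpS_mono' lpS_add_le lpS_const_mul)
open Literature.MathematicalPhysics.QuantumFieldTheory.Balaban1983to89.B4Lemma22CrossSup (lemma22_17_sup_box)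
open Literature.MathematicalPhysics.QuantumFieldTheory.Balaban1983to89.B4Lemma22SupStair (lemma22_17_sup_stair)
open Literature.MathematicalPhysics.QuantumFieldTheory.Balaban1983to89.B4Green242Bridge (boxNbrs)
open Literature.MathematicalPhysics.QuantumFieldTheory.Balaban1983to89.B4Eq220CommutatorZeroBox (HSize mem_boxNbrs_iff)
open Literature.MathematicalPhysics.QuantumFieldTheory.Balaban1983to89.B4PartitionUnity22 (hprof D1 D2 D1_nonneg
  D2_nonneg contDiff_hprof hasCompactSupport_hprof)
open Literature.MathematicalPhysics.QuantumFieldTheory.Balaban1983to89.B4Eq220PartitionSizes (hBox hsize_hBox)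
open Literature.MathematicalPhysics.QuantumFieldTheory.Balaban1983to89.B4Eq220CommutatorField (supN_mulH_le)

noncomputable section

variable {d : ℕ} {ι : Type} [Fintype ι] [DecidableEq ι]

/-! ## §1. (2.3): the Leibniz rule for `D^η_{W,μ}(hΦ)` and the bounds `‖D_μ(hΦ)‖ ≤ ‖D_μΦ‖ + δ₁‖Φ‖` -/

section Leibniz

variable (n : ℕ) {R : Finset (Fin (d + 1) → ℤ)} (W : ↥R → ↥R → Matrix ι ι ℝ) (μ : Fin (d + 1))

/-- **(2.3) AS PRINTED FOR `D^η_{W,μ}`** («(D^η_A hφ)(b) = h(b₊)(D^η_Aφ)(b) + (∂^ηh)(b)φ(b₋)»): at a site `x` whose `μ`-bond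
`⟨x, x + e_μ⟩` lies in the region, `(D_μ(hΦ))(x) = h(x + e_μ)·(D_μΦ)(x) + n(h(x + e_μ) − h(x))·Φ(x)` (`n = η⁻¹`).
[cite: Balaban1983RegularityDecay, (2.3) p. 575] -/
theorem fld_covDeriv_mulH_of_mem (h : ↥R → ℝ) (Φ : ↥R × ι → ℝ) {x : ↥R} (hx : x.1 + e1 μ ∈ R) :
    fld (covDeriv n R W μ *ᵥ (mulH (ι := ι) h *ᵥ Φ)) x
      = h ⟨x.1 + e1 μ, hx⟩ • fld (covDeriv n R W μ *ᵥ Φ) x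
        + ((n : ℝ) * (h ⟨x.1 + e1 μ, hx⟩ - h x)) • fld Φ x := by
  rw [fld_covDeriv_mulVec_of_mem n W _ hx, fld_covDeriv_mulVec_of_mem n W _ hx, fld_mulH_mulVec, fld_mulH_mulVec,
    Matrix.mulVec_smul]
  module

/-- at a site whose `μ`-bond leaves the region (Neumann), `(D_μ(hΦ))(x) = 0`. [cite: Balaban1983RegularityDecay, (1.3) p. 572, (2.3) p. 575] -/
theorem fld_covDeriv_mulH_of_not_mem (h : ↥R → ℝ) (Φ : ↥R × ι → ℝ) {x : ↥R} (hx : x.1 + e1 μ ∉ R) :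
    fld (covDeriv n R W μ *ᵥ (mulH (ι := ι) h *ᵥ Φ)) x = 0 :=
  fld_covDeriv_mulVec_of_not_mem n W _ hx

/-- the pointwise consequence of (2.3): `|(D_μ(hΦ))(x)| ≤ |(D_μΦ)(x)| + δ₁|Φ(x)|` under `|h| ≤ 1` and `|∂^η_μh| ≤ δ₁`
(`n|h(x + e_μ) − h(x)| ≤ δ₁`). [cite: Balaban1983RegularityDecay, (2.3) p. 575, p. 577 «|∂^ηh_j| ≤ O(M⁻¹)»] -/
theorem siteNorm_covDeriv_mulH_le {h : ↥R → ℝ} {δ₁ : ℝ} (hδ : 0 ≤ δ₁) (h1 : ∀ x, |h x| ≤ 1)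
    (hg : ∀ x y : ↥R, y.1 = x.1 + e1 μ → (n : ℝ) * |h y - h x| ≤ δ₁) (Φ : ↥R × ι → ℝ) (x : ↥R) :
    siteNorm (fld (covDeriv n R W μ *ᵥ (mulH (ι := ι) h *ᵥ Φ)) x)
      ≤ siteNorm (fld (covDeriv n R W μ *ᵥ Φ) x) + δ₁ * siteNorm (fld Φ x) := by
  by_cases hx : x.1 + e1 μ ∈ R
  · rw [fld_covDeriv_mulH_of_mem n W μ h Φ hx]
    refine (siteNorm_add_le _ _).trans (add_le_add ?_ ?_)
    · rw [siteNorm_smul]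
      exact mul_le_of_le_one_left (siteNorm_nonneg _) (h1 _)
    · rw [siteNorm_smul, abs_mul, abs_of_nonneg (Nat.cast_nonneg n)]
      exact mul_le_mul_of_nonneg_right (hg x ⟨_, hx⟩ rfl) (siteNorm_nonneg _)
  · rw [fld_covDeriv_mulH_of_not_mem n W μ h Φ hx, siteNorm_zero]
    exact add_nonneg (siteNorm_nonneg _) (mul_nonneg hδ (siteNorm_nonneg _))

/-- **`‖D^η_μ(hΦ)‖_∞ ≤ ‖D^η_μΦ‖_∞ + δ₁‖Φ‖_∞`** under `|h| ≤ 1`, `|∂^η_μh| ≤ δ₁`.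
[cite: Balaban1983RegularityDecay, (2.3) p. 575, p. 577] -/
theorem supN_covDeriv_mulH_le {h : ↥R → ℝ} {δ₁ : ℝ} (hδ : 0 ≤ δ₁) (h1 : ∀ x, |h x| ≤ 1)
    (hg : ∀ x y : ↥R, y.1 = x.1 + e1 μ → (n : ℝ) * |h y - h x| ≤ δ₁) (Φ : ↥R × ι → ℝ) :
    supN (covDeriv n R W μ *ᵥ (mulH (ι := ι) h *ᵥ Φ)) ≤ supN (covDeriv n R W μ *ᵥ Φ) + δ₁ * supN Φ :=
  supN_le (add_nonneg (supN_nonneg _) (mul_nonneg hδ (supN_nonneg _))) fun x =>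
    (siteNorm_covDeriv_mulH_le n W μ hδ h1 hg Φ x).trans
      (add_le_add (le_supN _ x) (mul_le_mul_of_nonneg_left (le_supN Φ x) hδ))

/-- **`‖D^η_μ(hΦ)‖_p ≤ ‖D^η_μΦ‖_p + δ₁‖Φ‖_p` FOR EVERY `p ≥ 1`** (Minkowski) under `|h| ≤ 1`, `|∂^η_μh| ≤ δ₁`.
[cite: Balaban1983RegularityDecay, (2.3) p. 575, p. 577] -/
theorem lpM_covDeriv_mulH_le {h : ↥R → ℝ} {δ₁ : ℝ} (hδ : 0 ≤ δ₁) (h1 : ∀ x, |h x| ≤ 1)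
    (hg : ∀ x y : ↥R, y.1 = x.1 + e1 μ → (n : ℝ) * |h y - h x| ≤ δ₁) {p : ℝ} (hp : 1 ≤ p)
    (Φ : ↥R × ι → ℝ) :
    lpM p (covDeriv n R W μ *ᵥ (mulH (ι := ι) h *ᵥ Φ)) ≤ lpM p (covDeriv n R W μ *ᵥ Φ) + δ₁ * lpM p Φ := by
  have hp0 : 0 < p := by linarith
  calc lpM p (covDeriv n R W μ *ᵥ (mulH (ι := ι) h *ᵥ Φ))
      ≤ lpS p (fun x => siteNorm (fld (covDeriv n R W μ *ᵥ Φ) x) + δ₁ * siteNorm (fld Φ x)) :=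
        lpS_mono' hp0 (fun _ => siteNorm_nonneg _) fun x => siteNorm_covDeriv_mulH_le n W μ hδ h1 hg Φ x
    _ ≤ lpS p (fun x => siteNorm (fld (covDeriv n R W μ *ᵥ Φ) x)) + lpS p (fun x => δ₁ * siteNorm (fld Φ x)) :=
        lpS_add_le hp _ _
    _ = lpM p (covDeriv n R W μ *ᵥ Φ) + δ₁ * lpM p Φ := by
        rw [lpS_const_mul hp0.ne' hδ]
        rfl

end Leibniz

/-! ## §2. The constant `c₁`: the first factor `hG_k(□,Ã)h` and its covariant derivative in the sup norm -/

section First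

/-- on a box, the `HSize` gradient bound gives the `μ`-bond bound used by §1. [folklore] -/
private theorem grad_of_HSize {n : ℕ} {M : Fin (d + 1) → ℕ} {h : ↥(boxDom fun j => n * M j) → ℝ} {δ₁ δ₂ δ₃ : ℝ}
    (hh : HSize n M h δ₁ δ₂ δ₃) (μ : Fin (d + 1)) (x y : ↥(boxDom fun j => n * M j)) (hy : y.1 = x.1 + e1 μ) :
    (n : ℝ) * |h y - h x| ≤ δ₁ :=
  hh.grad_le x y (mem_boxNbrs_iff.2 (mem_nbrs.2 ⟨μ, Or.inl hy⟩))

/-- **THE CONSTANT `c₁` OF (2.20)–(2.22) FOR THE MEMBERS OF (1.10) AT A REGULAR FIELD `Ã = A₀ + A′` ON A BOX, GENERAL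
CONTOUR SYSTEM**: with the constant `c` of `B4Lemma22CrossSup.lemma22_17_sup_box`, IF `H_k(□,Ã)` is invertible, `A′` has
bond size `θ/n`, bond derivative `θ′/n²`, vanishes on the bonds touching the faces, contour sums `≤ τ`, and the printed
smallness holds, THEN for every `h` of sizes `(δ₁, δ₂, δ₃)` (`HSize`) and every `Φ`, the first factor
«h_{ω₀}G_k(□_{ω₀},Ã_{ω₀})h_{ω₀}» obeys `‖hG_k(□,Ã)(hΦ)‖_∞ ≤ 2(d+2)c‖Φ‖_∞` and, for every `μ`,
`‖D^η_{Ã,μ}(hG_k(□,Ã)(hΦ))‖_∞ ≤ (1 + ℓθ + δ₁)·2(d+2)c‖Φ‖_∞` ((2.3) + the members `G`, `D^η_{Ã,μ}G` of (2.17) in the sup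
norm). [cite: Balaban1983RegularityDecay, (2.18), (2.20) p. 578 with (2.3) p. 575 and Lemma 2.2 (2.17) p. 578] -/
theorem eq218_first_sup_box (F : OrthFlow ι) {ℓ₁ : ℝ} (hℓ₁ : 0 ≤ ℓ₁)
    (hLip : ∀ t (v : ι → ℝ), ((F.U t - 1) *ᵥ v) ⬝ᵥ ((F.U t - 1) *ᵥ v) ≤ (ℓ₁ * t) ^ 2 * (v ⬝ᵥ v))
    (κ : ℝ) (d ℓ : ℕ) (hℓ : 1 ≤ ℓ) (amin aplus m2plus : ℝ) (ha : 0 < amin) :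
    ∃ c : ℝ, 0 < c ∧ ∀ (k : ℕ), 1 ≤ k → ∀ (a m2 : ℝ), amin ≤ a → a ≤ aplus → 0 ≤ m2 → m2 ≤ m2plus →
      ∀ (M : Fin (d + 1) → ℕ), (∀ i, 1 ≤ M i) →
      ∀ (emb : ↥(boxDom M) → ↥(Box d ℓ k M)) (Γ : ↥(boxDom M) → ↥(Box d ℓ k M) → List ↥(Box d ℓ k M)),
        (∀ y x, blkWt ((ℓ + 1) ^ k) M (fun i => (ℓ + 1) ^ k * M i) y x ≠ 0 → pathEnd (emb y) (Γ y x) = x) →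
      ∀ (A₀ : Fin (d + 1) → ℝ) (A' : ↥(Box d ℓ k M) → ↥(Box d ℓ k M) → ℝ) (θ θ' τ : ℝ),
        IsUnit (opA d F κ ℓ k a m2 M emb Γ (constBond A₀ Subtype.val + A')).det →
        0 ≤ θ → (∀ x y : ↥(Box d ℓ k M), y.1 ∈ nbrs x.1 → |κ * A' x y| ≤ θ / ((ℓ + 1) ^ k : ℕ)) →
        0 ≤ θ' → (∀ (x z y : ↥(Box d ℓ k M)) (μ : Fin (d + 1)), z.1 = x.1 + e1 μ → y.1 = z.1 + e1 μ →
          |κ * (A' y z - A' z x)| ≤ θ' / (((ℓ + 1) ^ k : ℕ) : ℝ) ^ 2 ∧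
          |κ * (A' x z - A' z y)| ≤ θ' / (((ℓ + 1) ^ k : ℕ) : ℝ) ^ 2) →
        (∀ (x y : ↥(Box d ℓ k M)) (μ : Fin (d + 1)), y.1 = x.1 + e1 μ →
          (x.1 - e1 μ ∉ Box d ℓ k M ∨ y.1 + e1 μ ∉ Box d ℓ k M) → A' x y = 0 ∧ A' y x = 0) →
        0 ≤ τ → (∀ y x, blkWt ((ℓ + 1) ^ k) M (fun i => (ℓ + 1) ^ k * M i) y x ≠ 0 →
          |κ * lsum A' (emb y) (Γ y x)| ≤ τ) →
        ((d : ℝ) + 2) * c * (((d : ℝ) + 1) * ℓ₁ * (θ + θ') + ((d : ℝ) + 1) * ℓ₁ * θ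
          + ((d : ℝ) + 1) * ℓ₁ ^ 2 * θ ^ 2 + B1.aSeq a ((ℓ : ℝ) + 1) k * (ℓ₁ * τ * (2 + ℓ₁ * τ))) ≤ 1 / 2 →
        ∀ (δ₁ δ₂ δ₃ : ℝ) (h : ↥(Box d ℓ k M) → ℝ), HSize ((ℓ + 1) ^ k) M h δ₁ δ₂ δ₃ →
        ∀ Φ : ↥(Box d ℓ k M) × ι → ℝ,
          supN (mulH (ι := ι) h *ᵥ (greenA d F κ ℓ k a m2 M emb Γ (constBond A₀ Subtype.val + A')
              *ᵥ (mulH (ι := ι) h *ᵥ Φ))) ≤ 2 * (((d : ℝ) + 2) * c) * supN Φ ∧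
          ∀ μ : Fin (d + 1),
            supN (derivA d F κ ℓ k M (constBond A₀ Subtype.val + A') μ
                *ᵥ (mulH (ι := ι) h *ᵥ (greenA d F κ ℓ k a m2 M emb Γ (constBond A₀ Subtype.val + A')
                  *ᵥ (mulH (ι := ι) h *ᵥ Φ))))
              ≤ (1 + ℓ₁ * θ + δ₁) * (2 * (((d : ℝ) + 2) * c)) * supN Φ := by
  obtain ⟨c, hc, hL⟩ := lemma22_17_sup_box F hℓ₁ hLip κ d ℓ hℓ amin aplus m2plus ha
  refine ⟨c, hc, ?_⟩
  intro k hk a m2 e1' e2 e3 e4 M hM emb Γ hend A₀ A' θ θ' τ hunit hθ hA' hθ' hder hbd hτ0 hτ hsm δ₁ δ₂ δ₃ h hh Φ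
  have hmem := hL k hk a m2 e1' e2 e3 e4 M hM emb Γ hend A₀ A' θ θ' τ hunit hθ hA' hθ' hder hbd hτ0 hτ hsm
  set G := greenA d F κ ℓ k a m2 M emb Γ (constBond A₀ Subtype.val + A') with hGdef
  have hC0 : 0 ≤ 2 * (((d : ℝ) + 2) * c) := by positivity
  have hG : ∀ Ψ, supN (G *ᵥ Ψ) ≤ 2 * (((d : ℝ) + 2) * c) * supN Ψ := fun Ψ => by
    have h1 := (hmem Ψ).1
    have hS : 0 ≤ ∑ μ, supN (derivA0 d F κ ℓ k M A₀ μ *ᵥ (G *ᵥ Ψ)) := sum_nonneg fun μ _ => supN_nonneg _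
    linarith
  have hhΦ : supN (mulH (ι := ι) h *ᵥ Φ) ≤ supN Φ := supN_mulH_le hh.abs_le Φ
  have hGh : supN (G *ᵥ (mulH (ι := ι) h *ᵥ Φ)) ≤ 2 * (((d : ℝ) + 2) * c) * supN Φ :=
    (hG _).trans (mul_le_mul_of_nonneg_left hhΦ hC0)
  refine ⟨(supN_mulH_le hh.abs_le _).trans hGh, fun μ => ?_⟩
  have hD : supN (derivA d F κ ℓ k M (constBond A₀ Subtype.val + A') μ *ᵥ (G *ᵥ (mulH (ι := ι) h *ᵥ Φ)))
      ≤ (1 + ℓ₁ * θ) * (2 * (((d : ℝ) + 2) * c)) * supN Φ :=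
    ((hmem _).2 μ).trans (mul_le_mul_of_nonneg_left hhΦ (by positivity))
  have hLeib := supN_covDeriv_mulH_le ((ℓ + 1) ^ k) (fieldLink F κ (constBond A₀ Subtype.val + A')) μ hh.nonneg₁
    hh.abs_le (grad_of_HSize hh μ) (G *ᵥ (mulH (ι := ι) h *ᵥ Φ))
  calc supN (derivA d F κ ℓ k M (constBond A₀ Subtype.val + A') μ
        *ᵥ (mulH (ι := ι) h *ᵥ (G *ᵥ (mulH (ι := ι) h *ᵥ Φ))))
      ≤ supN (derivA d F κ ℓ k M (constBond A₀ Subtype.val + A') μ *ᵥ (G *ᵥ (mulH (ι := ι) h *ᵥ Φ)))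
          + δ₁ * supN (G *ᵥ (mulH (ι := ι) h *ᵥ Φ)) := hLeib
    _ ≤ (1 + ℓ₁ * θ) * (2 * (((d : ℝ) + 2) * c)) * supN Φ + δ₁ * (2 * (((d : ℝ) + 2) * c) * supN Φ) :=
        add_le_add hD (mul_le_mul_of_nonneg_left hGh hh.nonneg₁)
    _ = (1 + ℓ₁ * θ + δ₁) * (2 * (((d : ℝ) + 2) * c)) * supN Φ := by ring

/-- **THE CONSTANT `c₁` FOR THE MEMBERS OF (1.10) ON A BOX WITH THE STAIRCASE CONTOURS — EVERYTHING DISCHARGED BUT THE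
PRINTED SMALLNESS OF THE FIELD** (`B4Lemma22SupStair.lemma22_17_sup_stair`):
`‖hG_k(□,Ã)(hΦ)‖_∞ ≤ 2(d+2)c‖Φ‖_∞`, `‖D^η_{Ã,μ}(hG_k(□,Ã)(hΦ))‖_∞ ≤ (1 + ℓθ + δ₁)·2(d+2)c‖Φ‖_∞`.
[cite: Balaban1983RegularityDecay, (2.18), (2.20) p. 578 with (2.3) p. 575 and Lemma 2.2 (2.17) p. 578] -/
theorem eq218_first_sup_stair (F : OrthFlow ι) {ℓ₁ : ℝ} (hℓ₁ : 0 ≤ ℓ₁)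
    (hLip : ∀ t (v : ι → ℝ), ((F.U t - 1) *ᵥ v) ⬝ᵥ ((F.U t - 1) *ᵥ v) ≤ (ℓ₁ * t) ^ 2 * (v ⬝ᵥ v))
    (κ : ℝ) (d ℓ : ℕ) (hℓ : 1 ≤ ℓ) (amin aplus m2plus : ℝ) (ha : 0 < amin) :
    ∃ c : ℝ, 0 < c ∧ ∀ (k : ℕ), 1 ≤ k → ∀ (hn : 1 ≤ (ℓ + 1) ^ k) (a m2 : ℝ),
      amin ≤ a → a ≤ aplus → 0 ≤ m2 → m2 ≤ m2plus →
      ∀ (M : Fin (d + 1) → ℕ), (∀ i, 1 ≤ M i) →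
      ∀ (A₀ : Fin (d + 1) → ℝ) (A' : ↥(Box d ℓ k M) → ↥(Box d ℓ k M) → ℝ) (θ θ' : ℝ),
        0 ≤ θ → (∀ x y : ↥(Box d ℓ k M), y.1 ∈ nbrs x.1 → |κ * A' x y| ≤ θ / ((ℓ + 1) ^ k : ℕ)) →
        0 ≤ θ' → (∀ (x z y : ↥(Box d ℓ k M)) (μ : Fin (d + 1)), z.1 = x.1 + e1 μ → y.1 = z.1 + e1 μ →
          |κ * (A' y z - A' z x)| ≤ θ' / (((ℓ + 1) ^ k : ℕ) : ℝ) ^ 2 ∧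
          |κ * (A' x z - A' z y)| ≤ θ' / (((ℓ + 1) ^ k : ℕ) : ℝ) ^ 2) →
        (∀ (x y : ↥(Box d ℓ k M)) (μ : Fin (d + 1)), y.1 = x.1 + e1 μ →
          (x.1 - e1 μ ∉ Box d ℓ k M ∨ y.1 + e1 μ ∉ Box d ℓ k M) → A' x y = 0 ∧ A' y x = 0) →
        ℓ₁ ^ 2 * θ ^ 2 * ((d : ℝ) + 1) * (1 + B1.aSeq a ((ℓ : ℝ) + 1) k * ((d : ℝ) + 1))
          ≤ min 2 (B1.aSeq a ((ℓ : ℝ) + 1) k) / 4 →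
        ((d : ℝ) + 2) * c * (((d : ℝ) + 1) * ℓ₁ * (θ + θ') + ((d : ℝ) + 1) * ℓ₁ * θ
          + ((d : ℝ) + 1) * ℓ₁ ^ 2 * θ ^ 2
          + B1.aSeq a ((ℓ : ℝ) + 1) k * (ℓ₁ * (((d : ℝ) + 1) * θ) * (2 + ℓ₁ * (((d : ℝ) + 1) * θ)))) ≤ 1 / 2 →
        ∀ (δ₁ δ₂ δ₃ : ℝ) (h : ↥(Box d ℓ k M) → ℝ), HSize ((ℓ + 1) ^ k) M h δ₁ δ₂ δ₃ →
        ∀ Φ : ↥(Box d ℓ k M) × ι → ℝ,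
          supN (mulH (ι := ι) h *ᵥ (greenA d F κ ℓ k a m2 M (baseEmb hn M) (stairContour hn M)
              (constBond A₀ Subtype.val + A') *ᵥ (mulH (ι := ι) h *ᵥ Φ))) ≤ 2 * (((d : ℝ) + 2) * c) * supN Φ ∧
          ∀ μ : Fin (d + 1),
            supN (derivA d F κ ℓ k M (constBond A₀ Subtype.val + A') μ
                *ᵥ (mulH (ι := ι) h *ᵥ (greenA d F κ ℓ k a m2 M (baseEmb hn M) (stairContour hn M)
                  (constBond A₀ Subtype.val + A') *ᵥ (mulH (ι := ι) h *ᵥ Φ))))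
              ≤ (1 + ℓ₁ * θ + δ₁) * (2 * (((d : ℝ) + 2) * c)) * supN Φ := by
  obtain ⟨c, hc, hL⟩ := lemma22_17_sup_stair F hℓ₁ hLip κ d ℓ hℓ amin aplus m2plus ha
  refine ⟨c, hc, ?_⟩
  intro k hk hn a m2 e1' e2 e3 e4 M hM A₀ A' θ θ' hθ hA' hθ' hder hbd hsm2 hsm δ₁ δ₂ δ₃ h hh Φ
  have hmem := hL k hk hn a m2 e1' e2 e3 e4 M hM A₀ A' θ θ' hθ hA' hθ' hder hbd hsm2 hsm
  set G := greenA d F κ ℓ k a m2 M (baseEmb hn M) (stairContour hn M) (constBond A₀ Subtype.val + A') with hGdef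
  have hC0 : 0 ≤ 2 * (((d : ℝ) + 2) * c) := by positivity
  have hG : ∀ Ψ, supN (G *ᵥ Ψ) ≤ 2 * (((d : ℝ) + 2) * c) * supN Ψ := fun Ψ => by
    have h1 := (hmem Ψ).1
    have hS : 0 ≤ ∑ μ, supN (derivA0 d F κ ℓ k M A₀ μ *ᵥ (G *ᵥ Ψ)) := sum_nonneg fun μ _ => supN_nonneg _
    linarith
  have hhΦ : supN (mulH (ι := ι) h *ᵥ Φ) ≤ supN Φ := supN_mulH_le hh.abs_le Φ
  have hGh : supN (G *ᵥ (mulH (ι := ι) h *ᵥ Φ)) ≤ 2 * (((d : ℝ) + 2) * c) * supN Φ :=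
    (hG _).trans (mul_le_mul_of_nonneg_left hhΦ hC0)
  refine ⟨(supN_mulH_le hh.abs_le _).trans hGh, fun μ => ?_⟩
  have hD : supN (derivA d F κ ℓ k M (constBond A₀ Subtype.val + A') μ *ᵥ (G *ᵥ (mulH (ι := ι) h *ᵥ Φ)))
      ≤ (1 + ℓ₁ * θ) * (2 * (((d : ℝ) + 2) * c)) * supN Φ :=
    ((hmem _).2 μ).trans (mul_le_mul_of_nonneg_left hhΦ (by positivity))
  have hLeib := supN_covDeriv_mulH_le ((ℓ + 1) ^ k) (fieldLink F κ (constBond A₀ Subtype.val + A')) μ hh.nonneg₁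
    hh.abs_le (grad_of_HSize hh μ) (G *ᵥ (mulH (ι := ι) h *ᵥ Φ))
  calc supN (derivA d F κ ℓ k M (constBond A₀ Subtype.val + A') μ
        *ᵥ (mulH (ι := ι) h *ᵥ (G *ᵥ (mulH (ι := ι) h *ᵥ Φ))))
      ≤ supN (derivA d F κ ℓ k M (constBond A₀ Subtype.val + A') μ *ᵥ (G *ᵥ (mulH (ι := ι) h *ᵥ Φ)))
          + δ₁ * supN (G *ᵥ (mulH (ι := ι) h *ᵥ Φ)) := hLeib
    _ ≤ (1 + ℓ₁ * θ) * (2 * (((d : ℝ) + 2) * c)) * supN Φ + δ₁ * (2 * (((d : ℝ) + 2) * c) * supN Φ) :=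
        add_le_add hD (mul_le_mul_of_nonneg_left hGh hh.nonneg₁)
    _ = (1 + ℓ₁ * θ + δ₁) * (2 * (((d : ℝ) + 2) * c)) * supN Φ := by ring

/-- **`c₁` FOR [B4]'s OWN `h_j`** (`B4Eq220PartitionSizes.hBox`, box sides multiples of the large-cube size `K ≥ 2`;
`δ₁ = (d+1)(D1(h) + D2(h))/K`): `‖h_jG_k(□,Ã)(h_jΦ)‖_∞ ≤ 2(d+2)c‖Φ‖_∞` and
`‖D^η_{Ã,μ}(h_jG_k(□,Ã)(h_jΦ))‖_∞ ≤ (1 + ℓθ + (d+1)(D1(h) + D2(h))/K)·2(d+2)c‖Φ‖_∞`, staircase contours.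
[cite: Balaban1983RegularityDecay, (2.18), (2.20) p. 578 with (2.3) p. 575, §2 p. 577, Lemma 2.2 (2.17) p. 578] -/
theorem eq218_first_hBox_sup_stair (F : OrthFlow ι) {ℓ₁ : ℝ} (hℓ₁ : 0 ≤ ℓ₁)
    (hLip : ∀ t (v : ι → ℝ), ((F.U t - 1) *ᵥ v) ⬝ᵥ ((F.U t - 1) *ᵥ v) ≤ (ℓ₁ * t) ^ 2 * (v ⬝ᵥ v))
    (κ : ℝ) (d ℓ : ℕ) (hℓ : 1 ≤ ℓ) (amin aplus m2plus : ℝ) (ha : 0 < amin) :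
    ∃ c : ℝ, 0 < c ∧ ∀ (k : ℕ), 1 ≤ k → ∀ (hn : 1 ≤ (ℓ + 1) ^ k) (a m2 : ℝ),
      amin ≤ a → a ≤ aplus → 0 ≤ m2 → m2 ≤ m2plus →
      ∀ (M : Fin (d + 1) → ℕ), (∀ i, 1 ≤ M i) → ∀ (K : ℕ) (j : Fin (d + 1) → ℤ), 2 ≤ K → (∀ μ, K ∣ M μ) →
      ∀ (A₀ : Fin (d + 1) → ℝ) (A' : ↥(Box d ℓ k M) → ↥(Box d ℓ k M) → ℝ) (θ θ' : ℝ),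
        0 ≤ θ → (∀ x y : ↥(Box d ℓ k M), y.1 ∈ nbrs x.1 → |κ * A' x y| ≤ θ / ((ℓ + 1) ^ k : ℕ)) →
        0 ≤ θ' → (∀ (x z y : ↥(Box d ℓ k M)) (μ : Fin (d + 1)), z.1 = x.1 + e1 μ → y.1 = z.1 + e1 μ →
          |κ * (A' y z - A' z x)| ≤ θ' / (((ℓ + 1) ^ k : ℕ) : ℝ) ^ 2 ∧
          |κ * (A' x z - A' z y)| ≤ θ' / (((ℓ + 1) ^ k : ℕ) : ℝ) ^ 2) →
        (∀ (x y : ↥(Box d ℓ k M)) (μ : Fin (d + 1)), y.1 = x.1 + e1 μ →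
          (x.1 - e1 μ ∉ Box d ℓ k M ∨ y.1 + e1 μ ∉ Box d ℓ k M) → A' x y = 0 ∧ A' y x = 0) →
        ℓ₁ ^ 2 * θ ^ 2 * ((d : ℝ) + 1) * (1 + B1.aSeq a ((ℓ : ℝ) + 1) k * ((d : ℝ) + 1))
          ≤ min 2 (B1.aSeq a ((ℓ : ℝ) + 1) k) / 4 →
        ((d : ℝ) + 2) * c * (((d : ℝ) + 1) * ℓ₁ * (θ + θ') + ((d : ℝ) + 1) * ℓ₁ * θ
          + ((d : ℝ) + 1) * ℓ₁ ^ 2 * θ ^ 2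
          + B1.aSeq a ((ℓ : ℝ) + 1) k * (ℓ₁ * (((d : ℝ) + 1) * θ) * (2 + ℓ₁ * (((d : ℝ) + 1) * θ)))) ≤ 1 / 2 →
        ∀ Φ : ↥(Box d ℓ k M) × ι → ℝ,
          supN (mulH (ι := ι) (hBox ((ℓ + 1) ^ k) K M j) *ᵥ (greenA d F κ ℓ k a m2 M (baseEmb hn M)
              (stairContour hn M) (constBond A₀ Subtype.val + A') *ᵥ (mulH (ι := ι) (hBox ((ℓ + 1) ^ k) K M j) *ᵥ Φ)))
            ≤ 2 * (((d : ℝ) + 2) * c) * supN Φ ∧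
          ∀ μ : Fin (d + 1),
            supN (derivA d F κ ℓ k M (constBond A₀ Subtype.val + A') μ
                *ᵥ (mulH (ι := ι) (hBox ((ℓ + 1) ^ k) K M j) *ᵥ (greenA d F κ ℓ k a m2 M (baseEmb hn M)
                  (stairContour hn M) (constBond A₀ Subtype.val + A')
                    *ᵥ (mulH (ι := ι) (hBox ((ℓ + 1) ^ k) K M j) *ᵥ Φ))))
              ≤ (1 + ℓ₁ * θ + ((d : ℝ) + 1) * (D1 hprof + D2 hprof) / K) * (2 * (((d : ℝ) + 2) * c)) * supN Φ := by
  obtain ⟨c, hc, hL⟩ := eq218_first_sup_stair F hℓ₁ hLip κ d ℓ hℓ amin aplus m2plus ha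
  refine ⟨c, hc, ?_⟩
  intro k hk hn a m2 e1' e2 e3 e4 M hM K j hK2 hKM A₀ A' θ θ' hθ hA' hθ' hder hbd hsm2 hsm Φ
  have hK1 : 1 ≤ K := le_trans (by norm_num) hK2
  have hn2 : 2 ≤ (ℓ + 1) ^ k := by
    calc 2 ≤ ℓ + 1 := by omega
      _ = (ℓ + 1) ^ 1 := (pow_one _).symm
      _ ≤ (ℓ + 1) ^ k := Nat.pow_le_pow_right (Nat.succ_pos ℓ) hk
  have hnK : 3 ≤ (ℓ + 1) ^ k * K := by nlinarith
  exact hL k hk hn a m2 e1' e2 e3 e4 M hM A₀ A' θ θ' hθ hA' hθ' hder hbd hsm2 hsm _ _ _ _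
    (hsize_hBox hn hK1 hnK hKM j) Φ

end First

end

end Literature.MathematicalPhysics.QuantumFieldTheory.Balaban1983to89.B4Eq218FirstFactor
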